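import Mathlib
import Summits.NavierStokesRegularity.NavierStokesRegularity.Theorems.FilamentSkeletonRssClause13LowSliceForm

/-!
# Clause 13-J/13-R, brick B8 (PARTITION KERNELS): physical-space frequency cut-offs from Schwartz profiles —
# `k = Re 𝓕⁻ψ` is real, `C¹`, with `k, t·k, t·k′, t²·k′ ∈ L¹`, `∫ k e^{izt} = ψ(−z/2π)` and `(k∗f)^ = ψ(−·/2π)·f̂`

Route `FilamentSkeletonRss`, ∃-side clause 13 (`Clause13RNearStraightL` stmt-NavierStokesRegularity-23612; typing-agnostic); design
`filament-plan/DESIGN-28296-model-gluing-g16.md` §4 n2.  The gluing of the four model windows (L/N/B/H) needs, for each smooth frequency profile, a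
PHYSICAL-SPACE kernel to which the commutator lemmas (`…Clause13CutoffCommutator(Refined)`, real `C¹` kernels with four `L¹` constants) and the
window estimates (stated through the un-normalised transform `f̂(z) = ∫f e^{izx}`) both apply.  Mathlib's Schwartz-space Fourier theory gives all of it:
for `ψ ∈ 𝓢(ℝ, ℂ)` REAL-valued and EVEN, with `k(t) := Re (𝓕⁻ψ)(t)` and `k′(t) := Re (𝓕⁻ψ)′(t)`:

* §1 `conj_fourier_eq_fourierInv`, `conj_fourierInv_schwartz` — `𝓕⁻ψ` is real-valued (`conj 𝓕f = 𝓕⁻f` for real `f`; `𝓕⁻f = 𝓕f` for even `f`);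
  `ofReal_re_fourierInv_schwartz` — `((k t : ℝ) : ℂ) = (𝓕⁻ψ)(t)`;
* §2 `hasDerivAt_reKernel`, continuity, and the four integrability facts (Schwartz decay, `SchwartzMap.integrable_pow_mul`);
* §3 `unnormalisedTransform_fourierInv_schwartz` — `∫ (𝓕⁻ψ)(t)e^{izt}dt = ψ(−z/(2π))` (Fourier inversion on `𝓢` + the dictionary
  `unnormalisedTransform_eq_fourier`, p672737);  `unnormalisedTransform_reKernel_conv` — `∫(∫k(x−y)f(y)dy)e^{izx}dx = ψ(−z/(2π))·f̂(z)` for `f ∈ L¹`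
  (Mathlib `Real.fourier_mul_convolution_eq`).
So a window profile `χ` (smooth, compactly supported, real, even in `x = z√q`) is realised by `ψ(ξ) := χ(−2πξ√q)` and the kernel `k = Re 𝓕⁻ψ`; sums of
profiles give sums of kernels (linearity of `𝓕⁻`).
Lane ns-filament-19175-p1 g16; `--supports stmt-NavierStokesRegularity-23612 --as helper`.
HONEST FRAMING: Fourier bookkeeping attached to a HYPOTHETICAL filament skeleton's linearised operator on the NEGATIVE side of a MODEL route; nothing
here bears on Navier–Stokes regularity or blow-up.
-/

noncomputable section

open MeasureTheory Real Complex Filter Set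
open scoped FourierTransform ComplexConjugate Topology Convolution

namespace Summit.NavierStokesRegularity.NavierStokesRegularity.Theorems.MatchedKernel
set_option linter.dupNamespace false

/-! ## §1 Real even profiles have real kernels -/

/-- For a real-valued `f : ℝ → ℂ`: `conj (𝓕f)(w) = (𝓕⁻f)(w)`. [folklore] -/
theorem conj_fourier_eq_fourierInv {f : ℝ → ℂ} (hf : ∀ v, conj (f v) = f v) (w : ℝ) :
    conj (𝓕 f w) = 𝓕⁻ f w := by
  rw [Real.fourierInv_eq_fourier_neg, Real.fourier_real_eq_integral_exp_smul, Real.fourier_real_eq_integral_exp_smul,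
    ← integral_conj]
  refine integral_congr_ae (Eventually.of_forall fun v => ?_)
  simp only [smul_eq_mul, map_mul, hf v, ← Complex.exp_conj, Complex.conj_ofReal, Complex.conj_I]
  congr 2
  push_cast
  ring

/-- **The kernel of a real even Schwartz profile is real-valued**: `conj (𝓕⁻ψ)(t) = (𝓕⁻ψ)(t)`. [folklore] -/
theorem conj_fourierInv_schwartz (ψ : SchwartzMap ℝ ℂ) (hre : ∀ v, conj (ψ v) = ψ v) (hev : ∀ v, ψ (-v) = ψ v) (t : ℝ) :
    conj ((𝓕⁻ ψ : SchwartzMap ℝ ℂ) t) = (𝓕⁻ ψ : SchwartzMap ℝ ℂ) t := by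
  have hcoe : ((𝓕⁻ ψ : SchwartzMap ℝ ℂ) : ℝ → ℂ) = 𝓕⁻ (ψ : ℝ → ℂ) := SchwartzMap.fourierInv_coe ψ
  have heven : (fun x : ℝ => (ψ : ℝ → ℂ) (-x)) = (ψ : ℝ → ℂ) := funext fun x => hev x
  have h1 : 𝓕⁻ (ψ : ℝ → ℂ) = 𝓕 (ψ : ℝ → ℂ) := by
    rw [Real.fourierInv_eq_fourier_comp_neg, heven]
  have h2 : conj (𝓕 (ψ : ℝ → ℂ) t) = 𝓕⁻ (ψ : ℝ → ℂ) t := conj_fourier_eq_fourierInv hre t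
  rw [show (𝓕⁻ ψ : SchwartzMap ℝ ℂ) t = (𝓕⁻ (ψ : ℝ → ℂ)) t from congrFun hcoe t]
  nth_rewrite 1 [h1]
  exact h2

/-- `((Re (𝓕⁻ψ)(t) : ℝ) : ℂ) = (𝓕⁻ψ)(t)` for a real even profile. [folklore] -/
theorem ofReal_re_fourierInv_schwartz (ψ : SchwartzMap ℝ ℂ) (hre : ∀ v, conj (ψ v) = ψ v) (hev : ∀ v, ψ (-v) = ψ v) (t : ℝ) :
    ((((𝓕⁻ ψ : SchwartzMap ℝ ℂ) t).re : ℝ) : ℂ) = (𝓕⁻ ψ : SchwartzMap ℝ ℂ) t :=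
  Complex.conj_eq_iff_re.1 (conj_fourierInv_schwartz ψ hre hev t)

/-! ## §2 The real kernel is `C¹` with the four `L¹` constants -/

/-- `k = Re 𝓕⁻ψ` has derivative `Re (𝓕⁻ψ)′`. [folklore] -/
theorem hasDerivAt_reKernel (φ : SchwartzMap ℝ ℂ) (t : ℝ) :
    HasDerivAt (fun s : ℝ => (φ s).re) ((SchwartzMap.derivCLM ℝ ℂ φ t).re) t := by
  have h := Complex.reCLM.hasFDerivAt.comp_hasDerivAt t (SchwartzMap.hasDerivAt φ t)
  rw [SchwartzMap.derivCLM_apply]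
  exact h.congr_deriv (by simp)

/-- `Re φ` and `Re φ′` are continuous. [folklore] -/
theorem continuous_reKernel (φ : SchwartzMap ℝ ℂ) : Continuous fun s : ℝ => (φ s).re :=
  Complex.continuous_re.comp φ.continuous

/-- `|t|^n · Re φ(t)` is integrable for a Schwartz `φ`. [folklore] -/
theorem integrable_pow_mul_reKernel (φ : SchwartzMap ℝ ℂ) (n : ℕ) : Integrable fun t : ℝ => t ^ n * (φ t).re := by
  have h := φ.integrable_pow_mul volume n
  refine h.mono' ?_ (Eventually.of_forall fun t => ?_)
  · exact ((continuous_id.pow n).mul (continuous_reKernel φ)).aestronglyMeasurable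
  · rw [Real.norm_eq_abs, abs_mul, abs_pow, ← Real.norm_eq_abs]
    exact mul_le_mul_of_nonneg_left (Complex.abs_re_le_norm _) (by positivity)

/-- `Re φ ∈ L¹`. [folklore] -/
theorem integrable_reKernel (φ : SchwartzMap ℝ ℂ) : Integrable fun t : ℝ => (φ t).re := by
  simpa using integrable_pow_mul_reKernel φ 0

/-- `t·Re φ ∈ L¹`. [folklore] -/
theorem integrable_mul_reKernel (φ : SchwartzMap ℝ ℂ) : Integrable fun t : ℝ => t * (φ t).re := by
  simpa using integrable_pow_mul_reKernel φ 1

/-- `t·Re φ′ ∈ L¹` (with `φ′ = derivCLM φ`). [folklore] -/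
theorem integrable_mul_reKernelDeriv (φ : SchwartzMap ℝ ℂ) :
    Integrable fun t : ℝ => t * (SchwartzMap.derivCLM ℝ ℂ φ t).re := by
  simpa using integrable_pow_mul_reKernel (SchwartzMap.derivCLM ℝ ℂ φ) 1

/-- `t²·Re φ′ ∈ L¹`. [folklore] -/
theorem integrable_sq_mul_reKernelDeriv (φ : SchwartzMap ℝ ℂ) :
    Integrable fun t : ℝ => t ^ 2 * (SchwartzMap.derivCLM ℝ ℂ φ t).re :=
  integrable_pow_mul_reKernel (SchwartzMap.derivCLM ℝ ℂ φ) 2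

/-! ## §3 Transforms: the kernel realises the profile, and cuts off `f̂` multiplicatively -/

/-- **`∫ (𝓕⁻ψ)(t)·e^{izt} dt = ψ(−z/(2π))`** (Fourier inversion on `𝓢`, in the un-normalised convention of the clause-13 bricks). [folklore] -/
theorem unnormalisedTransform_fourierInv_schwartz (ψ : SchwartzMap ℝ ℂ) (z : ℝ) :
    ∫ t : ℝ, (𝓕⁻ ψ : SchwartzMap ℝ ℂ) t * cexp (I * z * t) = ψ (-z / (2 * π)) := by
  rw [unnormalisedTransform_eq_fourier]
  have h1 : 𝓕 ((𝓕⁻ ψ : SchwartzMap ℝ ℂ) : ℝ → ℂ) = ((𝓕 (𝓕⁻ ψ : SchwartzMap ℝ ℂ) : SchwartzMap ℝ ℂ) : ℝ → ℂ) :=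
    (SchwartzMap.fourier_coe _).symm
  rw [h1, FourierInvPair.fourier_fourierInv_eq]

/-- **The real kernel realises the profile**: for a real even `ψ`, `∫ Re(𝓕⁻ψ)(t)·e^{izt} dt = ψ(−z/(2π))`. [folklore] -/
theorem unnormalisedTransform_reKernel (ψ : SchwartzMap ℝ ℂ) (hre : ∀ v, conj (ψ v) = ψ v) (hev : ∀ v, ψ (-v) = ψ v) (z : ℝ) :
    ∫ t : ℝ, ((((𝓕⁻ ψ : SchwartzMap ℝ ℂ) t).re : ℝ) : ℂ) * cexp (I * z * t) = ψ (-z / (2 * π)) := by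
  simp_rw [ofReal_re_fourierInv_schwartz ψ hre hev]
  exact unnormalisedTransform_fourierInv_schwartz ψ z

/-- The explicit convolution is Mathlib's `⋆[mul]`: `∫ k(x−y)f(y)dy = (k ⋆ f)(x)`. [folklore] -/
theorem integral_mul_sub_eq_convolution (k f : ℝ → ℂ) (x : ℝ) :
    ∫ y : ℝ, k (x - y) * f y = (k ⋆[ContinuousLinearMap.mul ℂ ℂ, volume] f) x := by
  rw [convolution_eq_swap]
  simp only [ContinuousLinearMap.mul_apply']

/-- **The kernel cuts off multiplicatively**: for `k ∈ L¹` (complex-valued) and `f ∈ L¹`,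
`∫ (∫ k(x−y)f(y)dy) e^{izx} dx = (∫ k e^{izt}dt)·(∫ f e^{izy}dy)`. [folklore; Mathlib `Real.fourier_mul_convolution_eq`] -/
theorem unnormalisedTransform_conv {k f : ℝ → ℂ} (hk : Integrable k) (hf : Integrable f) (z : ℝ) :
    ∫ x : ℝ, (∫ y : ℝ, k (x - y) * f y) * cexp (I * z * x)
      = (∫ t : ℝ, k t * cexp (I * z * t)) * ∫ y : ℝ, f y * cexp (I * z * y) := by
  simp_rw [integral_mul_sub_eq_convolution k f]
  rw [unnormalisedTransform_eq_fourier (k ⋆[ContinuousLinearMap.mul ℂ ℂ, volume] f), unnormalisedTransform_eq_fourier k,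
    unnormalisedTransform_eq_fourier f, Real.fourier_mul_convolution_eq hk hf]

/-- **Cut-off by the real kernel of a real even profile**: `∫(∫k(x−y)f(y)dy)e^{izx}dx = ψ(−z/(2π))·f̂(z)`, `k = Re 𝓕⁻ψ`, `f ∈ L¹`. [folklore] -/
theorem unnormalisedTransform_reKernel_conv (ψ : SchwartzMap ℝ ℂ) (hre : ∀ v, conj (ψ v) = ψ v) (hev : ∀ v, ψ (-v) = ψ v)
    {f : ℝ → ℂ} (hf : Integrable f) (z : ℝ) :
    ∫ x : ℝ, (∫ y : ℝ, ((((𝓕⁻ ψ : SchwartzMap ℝ ℂ) (x - y)).re : ℝ) : ℂ) * f y) * cexp (I * z * x)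
      = ψ (-z / (2 * π)) * ∫ y : ℝ, f y * cexp (I * z * y) := by
  simp_rw [ofReal_re_fourierInv_schwartz ψ hre hev]
  rw [unnormalisedTransform_conv (𝓕⁻ ψ : SchwartzMap ℝ ℂ).integrable hf z, unnormalisedTransform_fourierInv_schwartz]

end Summit.NavierStokesRegularity.NavierStokesRegularity.Theorems.MatchedKernel

end
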